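import Literature.Algebra.Module.TwoTermComplexBaseChangeMap
import Mathlib.LinearAlgebra.Dual.Lemmas
import HarnessLib

/-!
# The representing module `Q = (K⁰)^∨ ⧸ im d^∨` of a two-term complex is `(ker d)^∨`, and is projective iff
# `coker d` is (Mumford, *Abelian Varieties*, §5 Cor. 2; EGA III 7.8.4; Hartshorne III, Prop. 12.11)

Topic `Algebra/Module`; namespace `Literature.Algebra.Module`; a *proofs* file (theorems only; Mathlib +
★ `Algebra/Module/TwoTermComplexBaseChangeMap`). For an `A`-linear map `d : K⁰ → K¹` the kernel functor
`B ↦ ker(d ⊗_A B)` is represented by `Q = (K⁰)^∨ ⧸ im(d^∨)` (★ `Algebra/Module/TwoTermComplexBaseChange`,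
`exists_kerEquiv_quotient_dual`); ★ `TwoTermComplexBaseChange` proves cohomology-and-base-change in degree
`0` from projectivity of `Q`, ★ `TwoTermComplexBaseChangeMap` proves the CANONICAL form from projectivity of
`coker d = K¹ ⧸ im d`. This file identifies the two hypotheses:

* `range_dualMap_eq_dualAnnihilator_ker_of_projective_coker` — if `coker d` is projective then
  `im(d^∨) = ann(ker d)` (Mathlib's `range_dualMap_eq_dualAnnihilator_ker_of_subtype_range_surjective`, whose
  docstring names exactly this case);
* `exists_quotientDualEquiv_dual_ker` — if `K¹` and `coker d` are projective, `Q ≅ (ker d)^∨` along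
  restriction of functionals (`ker d` is then a direct summand of `K⁰`);
* `projective_quotient_dual_of_projective_coker` / `projective_coker_of_projective_quotient_dual` /
  **`projective_quotient_dual_iff_projective_coker`** — for `K⁰`, `K¹` finite projective, `Q` is projective
  iff `coker d` is (the converse by applying the direct statement to `d^∨` and reflexivity
  `K ≅ K^∨∨`, `map_evalEquiv_range_eq_range_dualMap_dualMap`);
* `exists_kerBaseChangeEquiv_canonical_of_projective_quotient_dual` — hence under the hypothesis of
  ★ `nonempty_baseChange_kerEquiv_of_projective` (`Q` projective) the CANONICAL base-change map
  `B ⊗_A ker d → ker(d ⊗_A B)` is already an isomorphism (EGA III 7.8.4 (d) ⇒ (a) in degree `0`).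

Everything is proved; no named facts; no definitions. Mathlib searched and used (pin):
`LinearMap.range_dualMap_eq_dualAnnihilator_ker_of_subtype_range_surjective`,
`LinearMap.ker_dualMap_eq_dualAnnihilator_range`, `LinearMap.quotKerEquivOfSurjective`,
`Submodule.quotEquivOfEq`, `Module.Projective.of_split`, `Module.Projective.of_equiv`,
`Module.evalEquiv` / `Module.Dual.eval_naturality` (finite projective modules are reflexive),
`Submodule.Quotient.equiv`, `Module.dual_projective`.
Cell `hodgecm-mathlib`, SOCKETS-F §3 node N-bc, leaf (G); count-neutral; B-p10 (g10).

## References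

* D. Mumford, *Abelian Varieties*, TIFR Studies in Mathematics 5 (1970), §5 Cor. 2 (p. 50). [MumfordAV1970]
* R. Hartshorne, *Algebraic Geometry*, GTM 52 (1977), III Prop. 12.11. [Hartshorne1977]
* A. Grothendieck, EGA III₂ (1963), 7.8.4.
-/

universe u

open Module

noncomputable section

namespace Literature.Algebra.Module

/-! ### §1 `Q ≅ (ker d)^∨` when `coker d` is projective -/

section Dual

variable {A : Type u} [CommRing A] {K0 K1 : Type u} [AddCommGroup K0] [Module A K0]
  [AddCommGroup K1] [Module A K1]

/-- A linear map with a retraction has a surjective dual (`i^∨ ∘ r^∨ = (r ∘ i)^∨ = id`). [folklore]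
[cite: MumfordAV1970, §5 Cor. 2 (p. 50)] -/
theorem dualMap_surjective_of_retraction {M N : Type u} [AddCommGroup M] [Module A M] [AddCommGroup N]
    [Module A N] (i : M →ₗ[A] N) (r : N →ₗ[A] M) (h : r ∘ₗ i = LinearMap.id) :
    Function.Surjective i.dualMap := by
  intro φ
  refine ⟨r.dualMap φ, ?_⟩
  rw [← LinearMap.comp_apply, LinearMap.dualMap_comp_dualMap, h, LinearMap.dualMap_id, LinearMap.id_apply]

/-- **`im(d^∨) = ann(ker d)`** when `coker d = K¹ ⧸ im d` is projective (then `im d ↪ K¹` has a retraction,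
so its dual is surjective; Mathlib `range_dualMap_eq_dualAnnihilator_ker_of_subtype_range_surjective`).
[cite: MumfordAV1970, §5 Cor. 2 (p. 50)] -/
theorem range_dualMap_eq_dualAnnihilator_ker_of_projective_coker (d : K0 →ₗ[A] K1)
    [Projective A (K1 ⧸ LinearMap.range d)] :
    LinearMap.range d.dualMap = (LinearMap.ker d).dualAnnihilator := by
  obtain ⟨r, hr⟩ := exists_retraction_range_of_projective_coker d
  exact LinearMap.range_dualMap_eq_dualAnnihilator_ker_of_subtype_range_surjective d
    (dualMap_surjective_of_retraction _ r hr)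

/-- **`Q = (K⁰)^∨ ⧸ im(d^∨) ≅ (ker d)^∨`** along restriction of functionals, when `K¹` and `coker d` are
projective: `im(d^∨) = ann(ker d) = ker(ι^∨)` for `ι : ker d ↪ K⁰`, and `ι^∨` is onto because `ι` has a
retraction (★ `exists_retraction_ker_of_projective_coker`). [cite: MumfordAV1970, §5 Cor. 2 (p. 50)] -/
theorem exists_quotientDualEquiv_dual_ker (d : K0 →ₗ[A] K1) [Projective A K1]
    [Projective A (K1 ⧸ LinearMap.range d)] :
    ∃ e : (Dual A K0 ⧸ LinearMap.range d.dualMap) ≃ₗ[A] Dual A (LinearMap.ker d),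
      ∀ φ : Dual A K0, e (Submodule.Quotient.mk φ) = (LinearMap.ker d).subtype.dualMap φ := by
  obtain ⟨r, hr⟩ := exists_retraction_ker_of_projective_coker d
  have hsurj := dualMap_surjective_of_retraction _ r hr
  have hker : LinearMap.range d.dualMap = LinearMap.ker (LinearMap.ker d).subtype.dualMap := by
    rw [range_dualMap_eq_dualAnnihilator_ker_of_projective_coker, LinearMap.ker_dualMap_eq_dualAnnihilator_range,
      Submodule.range_subtype]
  refine ⟨Submodule.quotEquivOfEq _ _ hker ≪≫ₗ LinearMap.quotKerEquivOfSurjective _ hsurj, fun φ => ?_⟩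
  rw [LinearEquiv.trans_apply]
  change LinearMap.quotKerEquivOfSurjective _ hsurj
    (Submodule.quotEquivOfEq _ _ hker (Submodule.Quotient.mk φ)) = _
  rw [Submodule.quotEquivOfEq_mk]
  exact LinearMap.quotKerEquivOfSurjective_apply_mk _ hsurj φ

/-- `ker d` is a direct summand of `K⁰`, hence projective, when `K⁰`, `K¹` and `coker d` are projective;
it is finite when `K⁰` is. [folklore] [cite: MumfordAV1970, §5 Cor. 2 (p. 50)] -/
theorem projective_ker_of_projective_coker (d : K0 →ₗ[A] K1) [Projective A K0] [Projective A K1]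
    [Projective A (K1 ⧸ LinearMap.range d)] : Projective A (LinearMap.ker d) := by
  obtain ⟨r, hr⟩ := exists_retraction_ker_of_projective_coker d
  exact Projective.of_split _ r hr

/-- `ker d` is finite when `K⁰` is and `K¹`, `coker d` are projective (it is a quotient of `K⁰` by the
retraction). [folklore] [cite: MumfordAV1970, §5 Cor. 2 (p. 50)] -/
theorem finite_ker_of_projective_coker (d : K0 →ₗ[A] K1) [Module.Finite A K0] [Projective A K1]
    [Projective A (K1 ⧸ LinearMap.range d)] : Module.Finite A (LinearMap.ker d) := by
  obtain ⟨r, hr⟩ := exists_retraction_ker_of_projective_coker d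
  exact Module.Finite.of_surjective r (Function.RightInverse.surjective (g := (LinearMap.ker d).subtype)
    fun x => by rw [← LinearMap.comp_apply, hr, LinearMap.id_apply])

/-- `im d` is a direct summand of `K¹`, hence projective, when `coker d` is. [folklore]
[cite: MumfordAV1970, §5 Cor. 2 (p. 50)] -/
theorem projective_range_of_projective_coker (d : K0 →ₗ[A] K1) [Projective A K1]
    [Projective A (K1 ⧸ LinearMap.range d)] : Projective A (LinearMap.range d) := by
  obtain ⟨r, hr⟩ := exists_retraction_range_of_projective_coker d
  exact Projective.of_split _ r hr

/-- **`Q` is projective when `coker d` is** (`K⁰` finite projective, `K¹` projective): `Q ≅ (ker d)^∨` and the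
dual of a finite projective module is projective. [cite: MumfordAV1970, §5 Cor. 2 (p. 50)] -/
theorem projective_quotient_dual_of_projective_coker (d : K0 →ₗ[A] K1) [Module.Finite A K0]
    [Projective A K0] [Projective A K1] [Projective A (K1 ⧸ LinearMap.range d)] :
    Projective A (Dual A K0 ⧸ LinearMap.range d.dualMap) := by
  obtain ⟨e, -⟩ := exists_quotientDualEquiv_dual_ker d
  haveI := projective_ker_of_projective_coker d
  haveI := finite_ker_of_projective_coker d
  exact Projective.of_equiv e.symm

end Dual

/-! ### §2 The converse by reflexivity: `coker d ≅ coker d^∨∨` -/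

section Reflexive

variable {A : Type u} [CommRing A] {K0 K1 : Type u} [AddCommGroup K0] [Module A K0]
  [AddCommGroup K1] [Module A K1]

/-- For reflexive `K⁰`, `K¹`: the evaluation isomorphism `K¹ ≅ K¹^∨∨` carries `im d` onto `im d^∨∨`
(`d^∨∨ ∘ ev = ev ∘ d`, Mathlib `Module.Dual.eval_naturality`). [folklore] [cite: MumfordAV1970, §5 Cor. 2 (p. 50)] -/
theorem map_evalEquiv_range_eq_range_dualMap_dualMap (d : K0 →ₗ[A] K1) [IsReflexive A K0]
    [IsReflexive A K1] :
    (LinearMap.range d).map (evalEquiv A K1 : K1 →ₗ[A] Dual A (Dual A K1)) =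
      LinearMap.range d.dualMap.dualMap := by
  rw [LinearMap.range_eq_map, ← Submodule.map_comp, evalEquiv_toLinearMap, ← Dual.eval_naturality,
    Submodule.map_comp, Submodule.map_top, ← evalEquiv_toLinearMap, LinearEquiv.range, ← LinearMap.range_eq_map]

/-- `coker d ≅ coker d^∨∨` for reflexive `K⁰`, `K¹`. [folklore] [cite: MumfordAV1970, §5 Cor. 2 (p. 50)] -/
theorem nonempty_cokerEquiv_coker_dualMap_dualMap (d : K0 →ₗ[A] K1) [IsReflexive A K0] [IsReflexive A K1] :
    Nonempty ((K1 ⧸ LinearMap.range d) ≃ₗ[A] (Dual A (Dual A K1) ⧸ LinearMap.range d.dualMap.dualMap)) :=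
  ⟨Submodule.Quotient.equiv _ _ (evalEquiv A K1) (map_evalEquiv_range_eq_range_dualMap_dualMap d)⟩

/-- **`coker d` is projective when `Q` is** (`K⁰`, `K¹` finite projective): apply
`projective_quotient_dual_of_projective_coker` to `d^∨ : (K¹)^∨ → (K⁰)^∨`, whose cokernel IS `Q`, to get
`coker d^∨∨` projective, and transport along `coker d ≅ coker d^∨∨`. [cite: MumfordAV1970, §5 Cor. 2 (p. 50)]
[cite: Hartshorne1977, III Prop. 12.11] -/
theorem projective_coker_of_projective_quotient_dual (d : K0 →ₗ[A] K1) [Module.Finite A K0]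
    [Projective A K0] [Module.Finite A K1] [Projective A K1]
    [Projective A (Dual A K0 ⧸ LinearMap.range d.dualMap)] : Projective A (K1 ⧸ LinearMap.range d) := by
  haveI : Projective A (Dual A (Dual A K1) ⧸ LinearMap.range d.dualMap.dualMap) :=
    projective_quotient_dual_of_projective_coker d.dualMap
  obtain ⟨e⟩ := nonempty_cokerEquiv_coker_dualMap_dualMap d
  exact Projective.of_equiv e.symm

/-- **The representing module `Q = (K⁰)^∨ ⧸ im d^∨` is projective iff `coker d` is**, for a two-term
complex of finite projective modules (the hypotheses of ★ `nonempty_baseChange_kerEquiv_of_projective` and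
of ★ `exists_kerBaseChangeEquiv_canonical` agree; EGA III 7.8.4). [cite: MumfordAV1970, §5 Cor. 2 (p. 50)]
[cite: Hartshorne1977, III Prop. 12.11] -/
theorem projective_quotient_dual_iff_projective_coker (d : K0 →ₗ[A] K1) [Module.Finite A K0]
    [Projective A K0] [Module.Finite A K1] [Projective A K1] :
    Projective A (Dual A K0 ⧸ LinearMap.range d.dualMap) ↔ Projective A (K1 ⧸ LinearMap.range d) :=
  ⟨fun _ => projective_coker_of_projective_quotient_dual d,
    fun _ => projective_quotient_dual_of_projective_coker d⟩

/-- **Cohomology and base change in degree `0`, canonical form, from projectivity of `Q`**: if the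
representing module `Q` is projective (`K⁰`, `K¹` finite projective) then for every `A`-algebra `B` the
CANONICAL map `B ⊗_A ker d → ker(d ⊗_A B)` is a `B`-linear isomorphism
(★ `exists_kerBaseChangeEquiv_canonical` + `projective_coker_of_projective_quotient_dual`).
[cite: MumfordAV1970, §5 Cor. 2 (p. 50)] [cite: Hartshorne1977, III Prop. 12.11] -/
theorem exists_kerBaseChangeEquiv_canonical_of_projective_quotient_dual (d : K0 →ₗ[A] K1)
    [Module.Finite A K0] [Projective A K0] [Module.Finite A K1] [Projective A K1]
    [Projective A (Dual A K0 ⧸ LinearMap.range d.dualMap)] (B : Type u) [CommRing B] [Algebra A B] :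
    ∃ e : TensorProduct A B (LinearMap.ker d) ≃ₗ[B] LinearMap.ker (d.baseChange B),
      ∀ x, ((e x : LinearMap.ker (d.baseChange B)) : TensorProduct A B K0) =
        (LinearMap.ker d).subtype.baseChange B x := by
  haveI := projective_coker_of_projective_quotient_dual d
  exact exists_kerBaseChangeEquiv_canonical d B

end Reflexive

end Literature.Algebra.Module

end
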